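import Mathlib
import HarnessLib
import Summits.NavierStokesRegularity.NavierStokesRegularity.Theorems.CompletionRelayChainPhaseIRun00
import Summits.NavierStokesRegularity.NavierStokesRegularity.Theorems.CompletionRelayChainPhaseIRun01
import Summits.NavierStokesRegularity.NavierStokesRegularity.Theorems.CompletionRelayChainPhaseIRun02
import Summits.NavierStokesRegularity.NavierStokesRegularity.Theorems.CompletionRelayChainPhaseIRun03
import Summits.NavierStokesRegularity.NavierStokesRegularity.Theorems.CompletionRelayChainPhaseIRun04
import Summits.NavierStokesRegularity.NavierStokesRegularity.Theorems.CompletionRelayChainPhaseIRun05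
import Summits.NavierStokesRegularity.NavierStokesRegularity.Theorems.CompletionRelayChainPhaseIRun06
import Summits.NavierStokesRegularity.NavierStokesRegularity.Theorems.CompletionRelayChainPhaseIRun07
import Summits.NavierStokesRegularity.NavierStokesRegularity.Theorems.CompletionRelayChainPhaseIRun08
import Summits.NavierStokesRegularity.NavierStokesRegularity.Theorems.CompletionRelayChainPhaseIRun09
import Summits.NavierStokesRegularity.NavierStokesRegularity.Theorems.CompletionRelayChainPhaseIRun10
import Summits.NavierStokesRegularity.NavierStokesRegularity.Theorems.CompletionRelayChainPhaseIRun11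
import Summits.NavierStokesRegularity.NavierStokesRegularity.Theorems.CompletionRelayChainPhaseIRun12
import Summits.NavierStokesRegularity.NavierStokesRegularity.Theorems.CompletionRelayChainPhaseIRun13
import Summits.NavierStokesRegularity.NavierStokesRegularity.Theorems.CompletionRelayChainPhaseIRun14
import Summits.NavierStokesRegularity.NavierStokesRegularity.Theorems.CompletionRelayChainPhaseIRun15
import Summits.NavierStokesRegularity.NavierStokesRegularity.Theorems.CompletionRelayChainPhaseIRun16
import Summits.NavierStokesRegularity.NavierStokesRegularity.Theorems.CompletionRelayChainPhaseIRun17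
import Summits.NavierStokesRegularity.NavierStokesRegularity.Theorems.CompletionRelayChainPhaseIRun18
import Summits.NavierStokesRegularity.NavierStokesRegularity.Theorems.CompletionRelayChainPhaseIRun19
import Summits.NavierStokesRegularity.NavierStokesRegularity.Theorems.CompletionRelayChainPhaseIRun20
import Summits.NavierStokesRegularity.NavierStokesRegularity.Theorems.CompletionRelayChainPhaseIRun21
import Summits.NavierStokesRegularity.NavierStokesRegularity.Theorems.CompletionRelayChainPhaseIRun22
import Summits.NavierStokesRegularity.NavierStokesRegularity.Theorems.CompletionRelayChainPhaseIRun23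
import Summits.NavierStokesRegularity.NavierStokesRegularity.Theorems.CompletionRelayChainPhaseIRun24
import Summits.NavierStokesRegularity.NavierStokesRegularity.Theorems.CompletionRelayChainPhaseIRun25
import Summits.NavierStokesRegularity.NavierStokesRegularity.Theorems.CompletionRelayChainPhaseIRun26
import Summits.NavierStokesRegularity.NavierStokesRegularity.Theorems.CompletionRelayChainPhaseIRun27
import Summits.NavierStokesRegularity.NavierStokesRegularity.Theorems.CompletionRelayChainPhaseIRun28
import Summits.NavierStokesRegularity.NavierStokesRegularity.Theorems.CompletionRelayChainPhaseIRun29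
import Summits.NavierStokesRegularity.NavierStokesRegularity.Theorems.CompletionRelayChainPhaseIRun30
import Summits.NavierStokesRegularity.NavierStokesRegularity.Theorems.CompletionRelayChainPhaseIRun31
import Summits.NavierStokesRegularity.NavierStokesRegularity.Theorems.CompletionRelayChainPhaseIRun32
import Summits.NavierStokesRegularity.NavierStokesRegularity.Theorems.CompletionRelayChainPhaseIRun33
import Summits.NavierStokesRegularity.NavierStokesRegularity.Theorems.CompletionRelayChainPhaseIRun34
import Summits.NavierStokesRegularity.NavierStokesRegularity.Theorems.CompletionRelayChainPhaseIRun35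
import Summits.NavierStokesRegularity.NavierStokesRegularity.Theorems.CompletionRelayChainPhaseIRun36
import Summits.NavierStokesRegularity.NavierStokesRegularity.Theorems.CompletionRelayChainPhaseIRun37
import Summits.NavierStokesRegularity.NavierStokesRegularity.Theorems.CompletionRelayChainPhaseIRun38
import Summits.NavierStokesRegularity.NavierStokesRegularity.Theorems.CompletionRelayChainPhaseIRun39
import Summits.NavierStokesRegularity.NavierStokesRegularity.Theorems.CompletionRelayChainPhaseIRun40

/-!
# Route `CompletionRelayChain` — crux `RelayFrontStep` (stmt-NavierStokesRegularity-24850), K-side of `stub_phaseI`,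
  work package K6 (closer): ALL 96 GRID CELLS PASS THE CHECKER — assembled from the 41 computational data modules
  `…PhaseIRun00` … `…PhaseIRun40` (each a `native_decide` replay of a contiguous chunk of `cells`)

MODEL-lattice bookkeeping (rung TL-M3-R64); nothing here is a statement about the Navier–Stokes equations.
-/

set_option linter.dupNamespace false

namespace Summit.NavierStokesRegularity.NavierStokesRegularity.Cruxes.RelayFrontStep.PhaseI.Checker

/-- The chunk table `(start, length)` of the data modules. [this file] -/
def packing : List (ℕ × ℕ) := [(0, 4), (4, 3), (7, 3), (10, 3), (13, 3), (16, 3), (19, 3), (22, 2), (24, 2), (26, 2), (28, 2), (30, 2), (32, 2), (34, 2), (36, 2), (38, 2), (40, 2), (42, 2), (44, 2), (46, 2), (48, 3), (51, 1), (52, 2), (54, 2), (56, 1), (57, 1), (58, 3), (61, 3), (64, 3), (67, 3), (70, 3), (73, 3), (76, 2), (78, 3), (81, 2), (83, 2), (85, 2), (87, 2), (89, 2), (91, 2), (93, 3)]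

/-- Every chunk passes (the 41 data modules). [this file] -/
theorem chunks_ok : ∀ p ∈ packing, ((cells.drop p.1).take p.2).all checkCell = true := by
  intro p hp
  simp only [packing, List.mem_cons, List.mem_nil_iff, or_false] at hp
  rcases hp with rfl | rfl | rfl | rfl | rfl | rfl | rfl | rfl | rfl | rfl | rfl | rfl | rfl | rfl | rfl | rfl | rfl |
    rfl | rfl | rfl | rfl | rfl | rfl | rfl | rfl | rfl | rfl | rfl | rfl | rfl | rfl | rfl | rfl | rfl | rfl | rfl | rfl |
    rfl | rfl | rfl | rfl
  · exact run_00
  · exact run_01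
  · exact run_02
  · exact run_03
  · exact run_04
  · exact run_05
  · exact run_06
  · exact run_07
  · exact run_08
  · exact run_09
  · exact run_10
  · exact run_11
  · exact run_12
  · exact run_13
  · exact run_14
  · exact run_15
  · exact run_16
  · exact run_17
  · exact run_18
  · exact run_19
  · exact run_20
  · exact run_21
  · exact run_22
  · exact run_23
  · exact run_24
  · exact run_25
  · exact run_26
  · exact run_27
  · exact run_28
  · exact run_29
  · exact run_30
  · exact run_31
  · exact run_32
  · exact run_33
  · exact run_34
  · exact run_35
  · exact run_36
  · exact run_37
  · exact run_38
  · exact run_39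
  · exact run_40

/-- The chunks cover every index below `96`. [this file] -/
theorem packing_covers : ∀ i < 96, ∃ p ∈ packing, p.1 ≤ i ∧ i < p.1 + p.2 := by decide

/-- `cells` has `96` entries. [this file] -/
theorem length_cells : cells.length = 96 := by
  simp [cells, List.length_flatMap]

/-- An element of a list lies in the chunk containing its index. [folklore] -/
theorem mem_chunk {α : Type} (l : List α) {i a n : ℕ} (hi : i < l.length) (hai : a ≤ i) (hin : i < a + n) :
    l[i] ∈ (l.drop a).take n := by
  rw [List.mem_iff_getElem]
  refine ⟨i - a, ?_, ?_⟩
  · simp only [List.length_take, List.length_drop]; omega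
  · simp only [List.getElem_take, List.getElem_drop]; congr 1; omega

/-- **ALL 96 CELLS PASS THE CHECKER.** [this file] -/
theorem cells_all : ∀ cell ∈ cells, checkCell cell = true := by
  intro cell hcell
  obtain ⟨i, hi, rfl⟩ := List.getElem_of_mem hcell
  obtain ⟨p, hp, hpa, hpn⟩ := packing_covers i (by rw [← length_cells]; exact hi)
  have h := chunks_ok p hp
  rw [List.all_eq_true] at h
  exact h _ (mem_chunk cells hi hpa hpn)

end Summit.NavierStokesRegularity.NavierStokesRegularity.Cruxes.RelayFrontStep.PhaseI.Checker
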